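import Summits.Langlands.Langlands.Theses.SeedParityLadder
import Summits.Langlands.Langlands.Theses.SenNullAlignment
import Summits.Langlands.Langlands.Theorems.SeedParityLadderHolomorphicSeedAvatarsStubSeedTransport
import Literature.NumberTheory.Automorphic.HilbertPartialWeightOneGaloisRep
import HarnessLib

/-!
# Crux `SeedParityLadder.HolomorphicSeedAvatars` (stmt-Langlands-27035, HOL) — line `birth`, composed

HOL = `QuarterConductorLadder.OffQuarterBoxAvatars` restricted to the box «`n = 2` and `π ≃ BC_K(π₀) ⊗ χ`
a.e. for a cuspidal `π₀` on `GL₂` over a totally real `K₀ ⊆ K`, `L`-algebraic, of infinity type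
`hilbertInfinityType k w` with some `k_β = 1`, the idèle `-1` at every infinite place of `K₀` acting by `-1`;
`χ` an `L`-algebraic `GL₁` datum over `K`»: for every `ℓ`, `ι` some semisimple `ρ : Γ_K → GL₂(ℚ̄_ℓ)` is
attached to `π` at almost all places.

The line `birth` (skeleton `Cruxes/HolomorphicSeedAvatars/Lines/birth.lean`) has two stubs:
* stub₂ `stub_seedTransport` — PROVED unconditionally
  (`Theorems/SeedParityLadderHolomorphicSeedAvatarsStubSeedTransport`: Weil's `ℓ`-adic avatar of `χ`,
  restriction `Frob_w ↦ Frob_u^{f(w|u)}`, twist, semisimplification);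
* stub₁ `stub_oddNonRegularAttached` = the TREE ITEM `SenNullAlignment.OddNonRegularAttached`
  (stmt-Langlands-16362) = the named Literature fact `exists_galoisRep_GL2_totallyReal_partialWeightOne`
  (Jarvis 1997 Thm. 6.1; Rogawski–Tunnell; Newton 2015 Thm. 1) instantiated
  (also recorded stand-alone in `Theorems/SeedParityLadderHolomorphicSeedAvatarsStubOddNonRegularAttachedOfPrint`,
  conditional).

Hence this file proves the crux BY NAME
* from the tree item `OddNonRegularAttached` alone (`holomorphicSeedAvatars_of_oddNonRegularAttached`:
  HOL ⟸ stmt-Langlands-16362, everything else discharged), and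
* from the named fact alone (`holomorphicSeedAvatars_of_partialWeightOne`: a CONDITIONAL result, D-0014 —
  the published theorem is not proved in the tree).
The crux is therefore reduced to PRINT: it closes the moment `exists_galoisRep_GL2_totallyReal_partialWeightOne`
(equivalently item 16362) is discharged; no other input is open.

References: F. Jarvis, J. reine angew. Math. 491 (1997), Thm. 6.1 [Jarvis1997]; J. Newton, Algebra Number
Theory 9 (2015), Thm. 1, Rem. 2 [Newton2015LowWeight]; A. Weil (1956) §1–2 [Weil1956]; P. Deligne,
J.-P. Serre, ASENS 7 (1974), 6.12.
-/

set_option linter.dupNamespace false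

namespace Summit.Langlands.Langlands.Theorems.HolomorphicSeedAvatars

open Literature.NumberTheory.Automorphic Literature.NumberTheory.GaloisRepresentations

/-- **HOL from the tree item `OddNonRegularAttached`** (stmt-Langlands-16362): the composition of line
`birth` with stub₂ discharged (`stub_seedTransport`).  Destructure the box (`n = 2`, the seed `π₀` over the
totally real `K₀ ⊆ K`, the `GL₁` datum `χ`, the a.e. relation), take the irreducible — hence semisimple —
avatar `r` of the seed from `OddNonRegularAttached` (its inlined weight-`(k, w)` infinity type and sign
clause are the box's, definitionally), and transport it to `K`. [cite: Jarvis1997, Thm. 6.1]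
[cite: Weil1956, §1–§2] -/
theorem holomorphicSeedAvatars_of_oddNonRegularAttached
    (hA : Summit.Langlands.Langlands.Theses.SenNullAlignment.OddNonRegularAttached) :
    Summit.Langlands.Langlands.Theses.SeedParityLadder.HolomorphicSeedAvatars := by
  intro K _ _ n hcpt _ π _ _ hhol _ _ ℓ _ ι
  obtain ⟨hn2, K₀, _, _, _, hTR, h₀, π₀, k, w, h₁, χ, hL₀, hT, hsgn, hk1, hχ, hrel⟩ := hhol
  subst hn2
  obtain ⟨r, hirr, hc⟩ := hA K₀ hTR h₀ π₀ k w hL₀ hT hsgn hk1 ℓ ι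
  have hss : r.toGaloisRep.IsSemisimple := by
    haveI : Representation.IsIrreducible r.toGaloisRep.toRepresentation := hirr
    change ComplementedLattice _
    infer_instance
  exact stub_seedTransport K₀ K hcpt π.1 ℓ ι h₀ π₀ h₁ χ r hss hc hχ hrel

/-- **HOL from the print** (CONDITIONAL on the named fact `exists_galoisRep_GL2_totallyReal_partialWeightOne`
= Jarvis 1997 Thm. 6.1 / Rogawski–Tunnell / Newton 2015 Thm. 1 in the tree's `L`-normalisation): the crux
`SeedParityLadder.HolomorphicSeedAvatars` by name, via `oddNonRegularAttached_of_partialWeightOne` and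
`holomorphicSeedAvatars_of_oddNonRegularAttached`.  [cite: Jarvis1997, Thm. 6.1 (and end of §3)]
[cite: Newton2015LowWeight, Thm. 1 and Rem. 2] -/
theorem holomorphicSeedAvatars_of_partialWeightOne
    (h : exists_galoisRep_GL2_totallyReal_partialWeightOne) :
    Summit.Langlands.Langlands.Theses.SeedParityLadder.HolomorphicSeedAvatars :=
  -- `OddNonRegularAttached` is the fact instantiated (definitionally; the idle hypothesis `∃ β, k β = 1`
  -- is dropped) — the same two lines as `oddNonRegularAttached_of_partialWeightOne` of
  -- `Theorems/SeedParityLadderHolomorphicSeedAvatarsStubOddNonRegularAttachedOfPrint`, inlined here so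
  -- that this file does not import a module in the cone of the route file `SenNullAlignment`.
  holomorphicSeedAvatars_of_oddNonRegularAttached fun K _ _ hK hcpt π k w hL hT hsgn _ ℓ _ ι =>
    h K hK hcpt π k w hL hT hsgn ℓ ι

end Summit.Langlands.Langlands.Theorems.HolomorphicSeedAvatars
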